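import Literature.NumberTheory.EllipticCurves.InertiaFixedTorsionAdditiveIndexBoundProofs
import Literature.NumberTheory.EllipticCurves.GreenbergSelmer
import Literature.NumberTheory.EllipticCurves.TateModule
import Literature.NumberTheory.EllipticCurves.AdditiveReductionSemistableModelProofs
import Literature.NumberTheory.EllipticCurves.OrdinaryPrimesProofs
import Literature.NumberTheory.EllipticCurves.LFunctionPrimeCoeff
import Literature.NumberTheory.EllipticCurves.BSDConductorProofs
import HarnessLib

/-!
# Additive reduction at `v ∤ p`, `p ≥ 5`: the inertia group fixes NO non-zero `p`-power torsion point
# (`E(K_v^nr)[p^∞] = 0`), and the local clause (c3) of the fine-Selmer roads is AUTOMATIC there (theorems only)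

`Proofs` file (theorems only: no definition, no named fact, no instance, no `sorry`), topic
`NumberTheory/EllipticCurves`; the `p ≥ 5` COROLLARY of the tree's counting theorem
`WeierstrassCurve.natCard_le_four_of_absInertia_fixed_of_hasAdditiveReductionAt`
(`InertiaFixedTorsionAdditiveIndexBoundProofs`: at an additive place `v ∤ p` a subgroup of `E[p]` fixed by the
local inertia group has at most `4` points — Silverman *AEC* Thm. VII.6.1 / Cor. VII.6.2 read over `K_v^nr`,
`E(K_v^nr)[p] ↪ E(K_v^nr)/E₀(K_v^nr)` of order `≤ 4`, from Tate's algorithm PROVED in the tree), in the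
currencies in which the cell `bsd-potss` consumes it:

* §1 `WeierstrassCurve.geomTorsion_eq_zero_of_absInertia_fixed_of_hasAdditiveReductionAt` — for `E/K` over a
  number field, `p ≥ 5` prime, `v ∤ p` of ADDITIVE reduction: a point of `E[p] ≤ E(K̄)` fixed by `absInertia K_v`
  (through `absGaloisRestrict K K_v`) is `O` (the cyclic group it generates has `p > 4` points otherwise);
  the same with the tree's global inertia / decomposition groups `GreenbergSelmer.inertia v ≤ GreenbergSelmer.decomp v`
  (`…_of_inertia_fixed_…`, `…_of_decomp_fixed_…`), and on the `p`-primary torsion `E[p^∞] = W.geomPrimaryTorsion p`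
  (`geomPrimaryTorsion_eq_zero_of_inertia_fixed_…`: **`E(K_v^nr)[p^∞] = 0`**, Greenberg LNM 1716 p. 88:
  "`c_v^{(p)} = |E(F_v)_p|`", here `p ∤ c_v ≤ 4`).
* §2 the clause **(c3)** of Deo–Ray–Sujatha / of the tree's fine-Selmer roads — VERBATIM the binder
  `hloc : ∀ v, (p ∈ v ∨ ¬ good at v) → ∀ x : W.geomPrimaryTorsion p, p • x = 0 → (∀ d ∈ decomp v, d • x = x) → x = 0`
  of `CoatesSujatha2005.SelmerTrivialRoad.conjA_of_selmerGroup_eq_bot` (`FineSelmerTrivialOfSelmerTrivial`) and of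
  `DeoRaySujatha2023.thm39_…` — holds at every additive `v ∤ p` (`p ≥ 5`), so that when EVERY bad place away from
  `p` is additive the binder reduces to its clauses at the places above `p`
  (`geomPrimaryTorsion_decomp_fixed_eq_zero_of_additive_away`).
* §3 over `ℚ`, for a globally minimal `W`: "every bad prime `ℓ ≠ p` is additive" is read off ONE integer
  divisibility `Δ_min(W) ∣ p^a · c₄(W)^b` (a bad `ℓ` divides `Δ_min`, hence `p` or `c₄`; `ℓ ∣ Δ_min`, `ℓ ∣ c₄` is
  additive reduction, Silverman VII.5.1(c), tree `hasAdditiveReductionAt_of_dvd_of_dvd`), and the place above `p`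
  is unique: `geomPrimaryTorsion_decomp_fixed_eq_zero_of_dvd_pow_mul_pow` turns the displayed `hloc` of a row
  into (one `decide`-able divisibility) + (the single clause at `p`).

Consumer: the per-row records of the cell `bsd-potss` (items stmt-BirchSwinnertonDyer-19413 / 19386, record lanes
`k8t-c4` / `k9-c4`), whose (c3) binder was so far a DISPLAYED numerical census (`drs_c3`).  What is NOT here: the
clause at `v ∣ p` itself (additive potentially supersingular `p`: a genuine condition, e.g. `E(ℚ₅)[5]` can be
`ℤ/5` when the semistability defect is `6`), the case `p = 3` (Kodaira types `IV`, `IV*` have `E[3]^{I_v} ≠ 0`,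
tree `InertiaFixedTorsionTypeIVProofs`), multiplicative `v` (Tate curve; Summits-side `X11b.LocalTorsion`).
Nothing is asserted about any curve; BSD / statement (A) is proved for no class of curves by this file.

## References

* [SilvermanAEC2009] J. H. Silverman, *The Arithmetic of Elliptic Curves*, 2nd ed. (2009): Thm. VII.6.1,
  Cor. VII.6.2 (PDF p. 177), Prop. VII.5.1 (PDF p. 174), proof of Thm. VII.7.1 (PDF p. 179), Cor. III.6.4.
* [SilvermanATAEC1994] J. H. Silverman, *Advanced Topics* (1994): Cor. IV.9.2 (d), Table 4.1 (PDF pp. 340, 365).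
* [GreenbergLNM1716] R. Greenberg, *Iwasawa theory for elliptic curves*, LNM 1716 (1999), §3 p. 88.
* [DeoRaySujatha2023] S. V. Deo, A. Ray, R. Sujatha, *On the `μ` equals zero conjecture for fine Selmer
  groups in Iwasawa theory*, Pure Appl. Math. Q. 19 (2023), Thm. 3.9 (c3).
* [NeukirchANT1999] J. Neukirch, *Algebraic Number Theory* (1999), Ch. I §8, Ch. II §9 Prop. (9.6).

Design: no definitions; one universe `u` for the number-field sections, `ℚ : Type` in §3; dot-notation
theorems in `namespace WeierstrassCurve` (deliberate extension, as the sibling `…Proofs` files).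
-/

noncomputable section

open scoped Classical
open NumberField IsDedekindDomain Field

universe u

namespace WeierstrassCurve

open Literature.NumberTheory.EllipticCurves Literature.NumberTheory.GaloisRepresentations
  Literature.NumberTheory.EllipticCurves.GreenbergSelmer IsDedekindDomain.HeightOneSpectrum

/-! ## §1 `E[p]^{I_v} = 0` and `E[p^∞]^{I_v} = 0` at an additive `v ∤ p`, `p ≥ 5` -/

section NumberField

variable {K : Type u} [Field K] [NumberField K] {v : HeightOneSpectrum (𝓞 K)} (W : WeierstrassCurve K)

/-- **`E(K_v^nr)[p] = 0` at an additive place `v ∤ p`, `p ≥ 5`** (local inertia group currency).  For `E/K`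
elliptic over a number field, a prime `p ≥ 5`, a finite place `v ∤ p` of ADDITIVE reduction and a point
`P ∈ E[p] ≤ E(K̄)` fixed by every element of `absInertia K_v` (acting through `absGaloisRestrict K K_v`):
`P = O`.  Proof: the cyclic group `ℤ P ≤ E[p]` is fixed pointwise, so it has at most `4` points
(`natCard_le_four_of_absInertia_fixed_of_hasAdditiveReductionAt`: `E(K_v^nr)[p] ↪ E(K_v^nr)/E₀(K_v^nr)`, order
`≤ 4`), while a non-zero `P` killed by the prime `p` generates `p ≥ 5` points.
[cite: SilvermanAEC2009, Thm. VII.6.1 with Cor. VII.6.2 (PDF p. 177) and proof of Thm. VII.7.1 (PDF p. 179)]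
[cite: GreenbergLNM1716, §3 p. 88] -/
theorem geomTorsion_eq_zero_of_absInertia_fixed_of_hasAdditiveReductionAt [W.IsElliptic]
    (hadd : W.HasAdditiveReductionAt v) {p : ℕ} (hp : p.Prime) (hp5 : 5 ≤ p)
    (hpv : (p : 𝓞 K) ∉ v.asIdeal) {P : geomPoints W} (hP : P ∈ geomTorsion W (p : ℤ))
    (hfix : ∀ σ ∈ absInertia (v.adicCompletion K), absGaloisRestrict K (v.adicCompletion K) σ • P = P) :
    P = 0 := by
  by_contra hP0
  haveI : Fact p.Prime := ⟨hp⟩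
  -- the cyclic subgroup `ℤ P ≤ E[p]`, fixed pointwise by the local inertia group
  have hle : AddSubgroup.zmultiples P ≤ geomTorsion W (p : ℤ) :=
    (AddSubgroup.zmultiples_le_of_mem hP)
  have hfixA : ∀ σ ∈ absInertia (v.adicCompletion K), ∀ Q ∈ AddSubgroup.zmultiples P,
      absGaloisRestrict K (v.adicCompletion K) σ • Q = Q := by
    rintro σ hσ Q ⟨k, rfl⟩
    change absGaloisRestrict K (v.adicCompletion K) σ • (k • P) = k • P
    rw [smul_comm, hfix σ hσ]
  have h4 : Nat.card (AddSubgroup.zmultiples P) ≤ 4 :=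
    W.natCard_le_four_of_absInertia_fixed_of_hasAdditiveReductionAt hadd hpv _ hle hfixA
  -- `#ℤP = p`
  have hpP : p • P = 0 := by
    rw [← natCast_zsmul]; exact (mem_geomTorsion_iff W (p : ℤ) P).mp hP
  have hord : addOrderOf P = p := addOrderOf_eq_prime hpP hP0
  rw [Nat.card_zmultiples, hord] at h4
  omega

/-- **`E[p]^{I_v} = 0` at an additive `v ∤ p`, `p ≥ 5`**, in the currency of the tree's GLOBAL inertia group
`GreenbergSelmer.inertia v ≤ Γ_K` (the image of `absInertia K_v` under `res : Γ_{K_v} → Γ_K` for the chosen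
embedding `K̄ → K̄_v`; Neukirch II (9.6)): a point of `E[p]` fixed by `I_v` is `O`.
[cite: SilvermanAEC2009, Thm. VII.6.1 with Cor. VII.6.2 (PDF p. 177)] [cite: NeukirchANT1999, Ch. II §9 Prop. (9.6)] -/
theorem geomTorsion_eq_zero_of_inertia_fixed_of_hasAdditiveReductionAt [W.IsElliptic]
    (hadd : W.HasAdditiveReductionAt v) {p : ℕ} (hp : p.Prime) (hp5 : 5 ≤ p)
    (hpv : (p : 𝓞 K) ∉ v.asIdeal) (P : geomTorsion W (p : ℤ))
    (hfix : ∀ d ∈ GreenbergSelmer.inertia v, d • P = P) : P = 0 := by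
  apply Subtype.ext
  refine W.geomTorsion_eq_zero_of_absInertia_fixed_of_hasAdditiveReductionAt hadd hp hp5 hpv P.2
    fun σ hσ ↦ ?_
  have hmem : absGaloisRestrict K (v.adicCompletion K) σ ∈ GreenbergSelmer.inertia v :=
    Subgroup.mem_map.mpr ⟨σ, hσ, rfl⟩
  have h := congrArg (fun Q : geomTorsion W (p : ℤ) ↦ (Q : geomPoints W)) (hfix _ hmem)
  simpa only [AddSubgroup.torsionBy.coe_smul] using h

/-- **`E[p]^{D_v} = 0` at an additive `v ∤ p`, `p ≥ 5`** (a fortiori: `I_v ≤ D_v`, tree `inertia_le_decomp`): a point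
of `E[p]` fixed by the decomposition group `GreenbergSelmer.decomp v` is `O` — the `E[p]`-currency of the clause (c3)
of the tree's door-L6 theorems (`CoatesSujatha2005.conjA_of_homTrivial_divisionField`, binder `hD`).
[cite: SilvermanAEC2009, Thm. VII.6.1 with Cor. VII.6.2 (PDF p. 177)] [cite: NeukirchANT1999, Ch. II §9 Prop. (9.6)] -/
theorem geomTorsion_eq_zero_of_decomp_fixed_of_hasAdditiveReductionAt [W.IsElliptic]
    (hadd : W.HasAdditiveReductionAt v) {p : ℕ} (hp : p.Prime) (hp5 : 5 ≤ p)
    (hpv : (p : 𝓞 K) ∉ v.asIdeal) (P : geomTorsion W (p : ℤ))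
    (hfix : ∀ d ∈ GreenbergSelmer.decomp v, d • P = P) : P = 0 :=
  W.geomTorsion_eq_zero_of_inertia_fixed_of_hasAdditiveReductionAt hadd hp hp5 hpv P
    fun d hd ↦ hfix d (GreenbergSelmer.inertia_le_decomp v hd)

/-- **`E(K_v^nr)[p^∞] = 0` at an additive `v ∤ p`, `p ≥ 5`**: a point of the `p`-primary torsion
`E[p^∞] = W.geomPrimaryTorsion p` fixed by the inertia group `GreenbergSelmer.inertia v` is `O` (Greenberg, LNM 1716
p. 88: at an additive place `|E(F_v)[p^∞]| = c_v^{(p)}`, the `p`-part of the Tamagawa number, `= 1` for `p ≥ 5`).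
If `p^n x = 0` with `n ≥ 1` then `y = p^{n-1} x ∈ E[p]` is inertia-fixed, so `y = 0` by the previous theorem,
i.e. the order of `x` drops; induction on `n`.
[cite: GreenbergLNM1716, §3 p. 88] [cite: SilvermanAEC2009, Thm. VII.6.1 with Cor. VII.6.2 (PDF p. 177)] -/
theorem geomPrimaryTorsion_eq_zero_of_inertia_fixed_of_hasAdditiveReductionAt [W.IsElliptic]
    (hadd : W.HasAdditiveReductionAt v) {p : ℕ} (hp : p.Prime) (hp5 : 5 ≤ p)
    (hpv : (p : 𝓞 K) ∉ v.asIdeal) (x : W.geomPrimaryTorsion p)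
    (hfix : ∀ d ∈ GreenbergSelmer.inertia v, d • x = x) : x = 0 := by
  obtain ⟨n, hn⟩ := x.2
  -- `hn : p ^ n • (x : geomPoints W) = 0`; induction on `n`
  induction n generalizing x with
  | zero =>
    apply Subtype.ext
    simpa using hn
  | succ k ih =>
    -- `y = p^k • x` is a point of `E[p]` fixed by `I_v`
    have hy : (p ^ k • (x : geomPoints W)) ∈ geomTorsion W (p : ℤ) := by
      rw [mem_geomTorsion_iff, natCast_zsmul, ← mul_nsmul', ← pow_succ']
      exact hn
    have hyfix : ∀ d ∈ GreenbergSelmer.inertia v,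
        d • (⟨p ^ k • (x : geomPoints W), hy⟩ : geomTorsion W (p : ℤ)) = ⟨p ^ k • (x : geomPoints W), hy⟩ := by
      intro d hd
      have hx : d • (x : geomPoints W) = (x : geomPoints W) := by
        have h := congrArg (fun z : W.geomPrimaryTorsion p ↦ (z : geomPoints W)) (hfix d hd)
        simpa only [primaryComponent.coe_smul] using h
      apply Subtype.ext
      rw [AddSubgroup.torsionBy.coe_smul, smul_comm, hx]
    have hy0 := W.geomTorsion_eq_zero_of_inertia_fixed_of_hasAdditiveReductionAt hadd hp hp5 hpv _ hyfix
    have hy0' : p ^ k • (x : geomPoints W) = 0 := congrArg Subtype.val hy0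
    exact ih x hfix hy0'

/-- **The clause (c3) at an additive `v ∤ p`, `p ≥ 5`, VERBATIM in the shape of the tree's binder `hloc`** (of
`CoatesSujatha2005.SelmerTrivialRoad.conjA_of_selmerGroup_eq_bot`, `DeoRaySujatha2023.thm39_…`): every
`x ∈ E[p^∞]` with `p x = 0` fixed by the decomposition group `GreenbergSelmer.decomp v` is `0`.
[cite: DeoRaySujatha2023, §3 Thm. 3.9 (c3) (arXiv:2202.09937 p. 10)]
[cite: SilvermanAEC2009, Thm. VII.6.1 with Cor. VII.6.2 (PDF p. 177)] -/
theorem geomPrimaryTorsion_eq_zero_of_decomp_fixed_of_hasAdditiveReductionAt [W.IsElliptic]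
    (hadd : W.HasAdditiveReductionAt v) {p : ℕ} (hp : p.Prime) (hp5 : 5 ≤ p)
    (hpv : (p : 𝓞 K) ∉ v.asIdeal) (x : W.geomPrimaryTorsion p) (_hpx : p • x = 0)
    (hfix : ∀ d ∈ GreenbergSelmer.decomp v, d • x = x) : x = 0 :=
  W.geomPrimaryTorsion_eq_zero_of_inertia_fixed_of_hasAdditiveReductionAt hadd hp hp5 hpv x
    fun d hd ↦ hfix d (GreenbergSelmer.inertia_le_decomp v hd)

/-! ## §2 The (c3) binder of the fine-Selmer roads when every bad place away from `p` is additive -/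

/-- **(c3) reduces to the places above `p` when every bad `v ∤ p` is additive** (`p ≥ 5`).  If every place of
bad reduction not above `p` is a place of ADDITIVE reduction, then the binder
`hloc : ∀ v, (p ∈ v ∨ ¬ good at v) → ∀ x : E[p^∞], p x = 0 → (∀ d ∈ D_v, d x = x) → x = 0` of the tree's
Selmer-trivial / Deo–Ray–Sujatha roads follows from its clauses at the places `v ∋ p` alone.
[cite: DeoRaySujatha2023, §3 Thm. 3.9 (c3) (arXiv:2202.09937 p. 10)]
[cite: SilvermanAEC2009, Thm. VII.6.1 with Cor. VII.6.2 (PDF p. 177)] -/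
theorem geomPrimaryTorsion_decomp_fixed_eq_zero_of_additive_away [W.IsElliptic] {p : ℕ} (hp : p.Prime)
    (hp5 : 5 ≤ p)
    (hbad : ∀ v : HeightOneSpectrum (𝓞 K), ¬ W.HasGoodReductionAt v → (p : 𝓞 K) ∉ v.asIdeal →
      W.HasAdditiveReductionAt v)
    (hlocp : ∀ v : HeightOneSpectrum (𝓞 K), (p : 𝓞 K) ∈ v.asIdeal →
      ∀ x : W.geomPrimaryTorsion p, p • x = 0 → (∀ d ∈ GreenbergSelmer.decomp v, d • x = x) → x = 0) :
    ∀ v : HeightOneSpectrum (𝓞 K), ((p : 𝓞 K) ∈ v.asIdeal ∨ ¬ W.HasGoodReductionAt v) →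
      ∀ x : W.geomPrimaryTorsion p, p • x = 0 → (∀ d ∈ GreenbergSelmer.decomp v, d • x = x) → x = 0 := by
  intro v hv x hpx hfix
  by_cases hpv : (p : 𝓞 K) ∈ v.asIdeal
  · exact hlocp v hpv x hpx hfix
  · have hb : ¬ W.HasGoodReductionAt v := hv.resolve_left hpv
    exact W.geomPrimaryTorsion_eq_zero_of_decomp_fixed_of_hasAdditiveReductionAt (hbad v hb hpv) hp hp5 hpv
      x hpx hfix

end NumberField

/-! ## §3 Over `ℚ`: additivity away from `p` from ONE divisibility `Δ_min ∣ p^a · c₄^b` -/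

section Rat

open Rat.HeightOneSpectrum

variable (W : WeierstrassCurve ℚ) [W.IsElliptic] [W.IsGloballyMinimal]

omit [W.IsElliptic] [W.IsGloballyMinimal] in
/-- The place of `ℚ` above a rational prime `p` is unique: a clause stated at ONE place `v₀ ∋ p` holds at every
place containing `p`. [cite: NeukirchANT1999, Ch. I §8] -/
theorem forall_of_natCast_mem_asIdeal {p : ℕ} (hp : p.Prime) {C : HeightOneSpectrum (𝓞 ℚ) → Prop}
    (v₀ : HeightOneSpectrum (𝓞 ℚ)) (hv₀ : (p : 𝓞 ℚ) ∈ v₀.asIdeal) (h : C v₀) :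
    ∀ v : HeightOneSpectrum (𝓞 ℚ), (p : 𝓞 ℚ) ∈ v.asIdeal → C v := by
  intro v hv
  have h₁ := (natCast_mem_asIdeal_iff_eq_primesEquiv_symm v hp).mp hv
  have h₀ := (natCast_mem_asIdeal_iff_eq_primesEquiv_symm v₀ hp).mp hv₀
  rw [h₁, ← h₀]
  exact h

/-- **A bad place `v ∤ p` is additive when `Δ_min ∣ p^a · c₄^b`** (`W/ℚ` globally minimal): the prime `ℓ` under a
place of bad reduction divides `Δ_min` (Silverman VII.5.1 (a), tree `hasGoodReductionAtPrime_of_not_dvd`), hence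
`p^a c₄^b`, hence `c₄` (`ℓ ≠ p`); and `ℓ ∣ Δ_min`, `ℓ ∣ c₄` is additive reduction for a minimal equation
(Silverman VII.5.1 (c), tree `hasAdditiveReductionAt_of_dvd_of_dvd`).  `c₄` is the `c₄` of the minimal model
`integralModelInt W`. [cite: SilvermanAEC2009, VII.5 Prop. 5.1 (a), (c) (PDF p. 174)] -/
theorem hasAdditiveReductionAt_of_not_hasGoodReductionAt_of_dvd_pow_mul_pow {p : ℕ} (hp : p.Prime) {a b : ℕ}
    (hrad : minimalDiscriminantInt W ∣ (p : ℤ) ^ a * (integralModelInt W).c₄ ^ b)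
    (v : HeightOneSpectrum (𝓞 ℚ)) (hbad : ¬ W.HasGoodReductionAt v) (hpv : (p : 𝓞 ℚ) ∉ v.asIdeal) :
    W.HasAdditiveReductionAt v := by
  haveI := Fact.mk (primesEquiv v).2
  have hℓ : ((primesEquiv v : Nat.Primes) : ℕ).Prime := (primesEquiv v).2
  -- `ℓ ∣ Δ_min`
  have hΔ : (((primesEquiv v : Nat.Primes) : ℕ) : ℤ) ∣ minimalDiscriminantInt W := by
    by_contra hnd
    exact hbad ((hasGoodReductionAtPrime_iff_hasGoodReductionAt_ringOfIntegers v W).mp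
      (hasGoodReductionAtPrime_of_not_dvd W _ hnd))
  have hℓZ : Prime ((((primesEquiv v : Nat.Primes) : ℕ) : ℤ)) := Nat.prime_iff_prime_int.mp hℓ
  -- `ℓ ∣ p^a c₄^b`, and `ℓ ∤ p`
  rcases hℓZ.dvd_or_dvd (hΔ.trans hrad) with h | h
  · exfalso
    have h1 : ((primesEquiv v : Nat.Primes) : ℕ) ∣ p := Int.natCast_dvd_natCast.mp (hℓZ.dvd_of_dvd_pow h)
    have h2 : primesEquiv v = ⟨p, hp⟩ := Subtype.ext ((Nat.prime_dvd_prime_iff_eq hℓ hp).mp h1)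
    exact hpv ((natCast_mem_asIdeal_iff_eq_primesEquiv_symm v hp).mpr ((Equiv.eq_symm_apply _).mpr h2))
  · exact W.hasAdditiveReductionAt_of_dvd_of_dvd v hΔ (hℓZ.dvd_of_dvd_pow h)

/-- **(c3) over `ℚ` from one divisibility and the clause at `p`** (`p ≥ 5`, `W` globally minimal): if
`Δ_min(W) ∣ p^a · c₄(W)^b` (every bad prime `ℓ ≠ p` is additive) and the (c3) clause holds at ONE place `v₀ ∋ p`, then
the full binder `hloc` of the tree's Selmer-trivial / Deo–Ray–Sujatha roads holds (at `v ∋ p`: the place above `p`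
is unique; at a bad `v ∤ p`: additive, `E[p^∞]^{I_v} = 0`).
[cite: DeoRaySujatha2023, §3 Thm. 3.9 (c3) (arXiv:2202.09937 p. 10)]
[cite: SilvermanAEC2009, Thm. VII.6.1 with Cor. VII.6.2 (PDF p. 177) and VII.5 Prop. 5.1 (PDF p. 174)] -/
theorem geomPrimaryTorsion_decomp_fixed_eq_zero_of_dvd_pow_mul_pow {p : ℕ} (hp : p.Prime) (hp5 : 5 ≤ p)
    {a b : ℕ} (hrad : minimalDiscriminantInt W ∣ (p : ℤ) ^ a * (integralModelInt W).c₄ ^ b)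
    (v₀ : HeightOneSpectrum (𝓞 ℚ)) (hv₀ : (p : 𝓞 ℚ) ∈ v₀.asIdeal)
    (hlocp : ∀ x : W.geomPrimaryTorsion p, p • x = 0 → (∀ d ∈ GreenbergSelmer.decomp v₀, d • x = x) → x = 0) :
    ∀ v : HeightOneSpectrum (𝓞 ℚ), ((p : 𝓞 ℚ) ∈ v.asIdeal ∨ ¬ W.HasGoodReductionAt v) →
      ∀ x : W.geomPrimaryTorsion p, p • x = 0 → (∀ d ∈ GreenbergSelmer.decomp v, d • x = x) → x = 0 :=
  W.geomPrimaryTorsion_decomp_fixed_eq_zero_of_additive_away hp hp5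
    (fun v hb hpv ↦ W.hasAdditiveReductionAt_of_not_hasGoodReductionAt_of_dvd_pow_mul_pow hp hrad v hb hpv)
    (forall_of_natCast_mem_asIdeal hp
      (C := fun v ↦ ∀ x : W.geomPrimaryTorsion p, p • x = 0 →
        (∀ d ∈ GreenbergSelmer.decomp v, d • x = x) → x = 0) v₀ hv₀ hlocp)

end Rat

end WeierstrassCurve

end
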